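import Mathlib.Data.Finset.Max
import HarnessLib

/-!
# The P-continuum RECORD of a material and its `by_P` lookup: precedence, «never a manufactured
# computed cell», words extend across a decided gap while the confidence class does not

Venture CertifiedManyBodySolver, cell `pub/hubbard-downfold` (S1 = downfolding front end = ROUTER),
seat hubbard-downfold-mod-2; namespace `Summit.Ventures.CertifiedManyBodySolver.Downfold.PCont`.
This is the KERNEL REFERENCE for two derived files of record and one answered format question:

* `router/P-CONTINUUM.tsv` (mod-2; per material the P axis partitioned into COMPUTED columns,
  open INTERVALS between consecutive computed columns — «interpolated (P.12e)» or «undetermined» —,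
  one-sided REACHES (§P.12(c′)) and the UNROUTED remainder; precedence computed > reach > interval >
  unrouted) and `router/P-BYP.json` (the same read at every TRUTH column);
* score-1's answer (2026-08-27T01:08:29Z, oracle-dag E18) to «where do P-interval router words live in
  a map»: cells stay POINTS; a request-grid pressure strictly inside an interval gets a
  `header.router.by_P[]` item `{status ∈ interpolated | undetermined, words, interval}`; an
  interpolated ROUTER word licenses the branch at that pressure, never a cell word, and is never a
  «computed» item.

The record (`Rec π ω`, pressures `π` any linear order, words `ω`): the finite set `pts` of computed
pressures with their words `cw`, the word `gw a` of the open gap whose LEFT end is the computed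
pressure `a` (`none` = «undetermined (P-interpolation)»), and the reach word `rw P` covering a
pressure (`none` = no reach). `lookup R P` is the `by_P` item at `P` under the precedence.

PROVED: `lookup_of_mem` / `kind_eq_computed_iff` — **an item is «computed» iff its pressure IS a
computed column** (the join never manufactures a computed cell; E18 (3)); `gapLeft_eq` /
`gapRight_eq` (between two CONSECUTIVE computed pressures the bracketing columns are those two);
`lookup_of_mem_gap` (inside a gap with no reach the item is the interval item of that gap);
`word_eq_on_gap_of_decided` + `conf_lookup_of_mem_gap` — on a DECIDED gap (interval word `w` equal
to both end words — the invariant `Router.IntervalCert.route_left/route_right` of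
`Downfold.PressureContinuum` makes automatic for a certified sub-interval) **the WORD `w` is the
item's word at every pressure of the CLOSED gap while the confidence class is «screening» exactly
at the two end columns and «interpolated» strictly inside** (words extend, confidence does not;
E18 (3)/(4)); `lookup_reach_of_not_mem` (a reach item never sits on a computed column and beats
the interval item where both apply — the FLANK word inside an undetermined gap, §P.12(h)/(c′)).
WHAT THIS IS NOT: a reading of any material (the records are mod-2's files; the certificates
behind «interpolated» are `Downfold.PressureContinuum{,Runs}`); not a cell word or a score rule.
-/

namespace Summit.Ventures.CertifiedManyBodySolver.Downfold

namespace PCont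

/-- Segment kinds of the P continuum, listed in PRECEDENCE order (computed > reach > interval >
unrouted). [folklore] -/
inductive Kind
  /-- a computed column (box of record AT this pressure) -/
  | computed
  /-- a one-sided reach from a computed column (§P.12(c′)) -/
  | reach
  /-- the open interval between two consecutive computed columns (§P.12(e)/(h)) -/
  | interval
  /-- below the lowest / above the highest routed pressure -/
  | unrouted
  deriving DecidableEq, Repr

/-- Confidence classes of a `by_P` item (ACCEPTANCE / P-CONTINUUM `conf_class`). [folklore] -/
inductive Conf
  /-- screening-grade: the box of record at a computed pressure -/
  | screening
  /-- interpolated (P.12e): a decided open interval -/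
  | interpolated
  /-- extrapolated (P.12c′): a one-sided reach -/
  | extrapolated
  /-- no router word at this pressure (undetermined interval or unrouted) -/
  | none
  deriving DecidableEq, Repr

/-- A `by_P` item: segment kind and the router word it carries (`none` = no word). [folklore] -/
structure Item (ω : Type*) where
  /-- the segment kind the pressure falls in, after precedence -/
  kind : Kind
  /-- the router word carried (`none` = «undetermined» / unrouted) -/
  word : Option ω

/-- The confidence class of an item: computed ↦ screening; reach ↦ extrapolated; a DECIDED interval
↦ interpolated; an undetermined interval or an unrouted pressure ↦ none. [folklore] -/
def Item.conf {ω : Type*} : Item ω → Conf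
  | ⟨.computed, _⟩ => .screening
  | ⟨.reach, _⟩ => .extrapolated
  | ⟨.interval, some _⟩ => .interpolated
  | ⟨.interval, none⟩ => .none
  | ⟨.unrouted, _⟩ => .none

/-- **The P-continuum RECORD of one material**: computed pressures `pts` with words `cw`; `gw a` =
the word of the OPEN gap whose left end is the computed pressure `a` (`none` = undetermined);
`rw P` = the word of a reach covering `P` (`none` = no reach there). [folklore] -/
structure Rec (π ω : Type*) where
  /-- the computed pressures (columns of record) -/
  pts : Finset π
  /-- the word of record at a computed pressure (read on `pts` only) -/
  cw : π → ω
  /-- the interval word of the open gap to the RIGHT of a computed pressure (`none` = undetermined) -/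
  gw : π → Option ω
  /-- the reach word covering a pressure (`none` = no admissible reach) -/
  rw : π → Option ω

namespace Rec

variable {π ω : Type*} [LinearOrder π] (R : Rec π ω)

/-- Computed pressures strictly below `P`. [folklore] -/
def below (P : π) : Finset π := R.pts.filter (· < P)

/-- Computed pressures strictly above `P`. [folklore] -/
def above (P : π) : Finset π := R.pts.filter (P < ·)

/-- The nearest computed pressure strictly below `P` (`none` below the lowest column). [folklore] -/
def gapLeft (P : π) : Option π :=
  if h : (R.below P).Nonempty then some ((R.below P).max' h) else none

/-- The nearest computed pressure strictly above `P` (`none` above the highest column). [folklore] -/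
def gapRight (P : π) : Option π :=
  if h : (R.above P).Nonempty then some ((R.above P).min' h) else none

/-- The item of a non-computed, reach-free pressure: the interval item of its gap when it lies
between two computed columns, else unrouted. [folklore] -/
def gapItem (P : π) : Item ω :=
  match R.gapLeft P, R.gapRight P with
  | some a, some _ => ⟨.interval, R.gw a⟩
  | _, _ => ⟨.unrouted, none⟩

/-- The item of a non-computed pressure: a covering reach wins over the gap item. [folklore] -/
def offItem (P : π) : Item ω :=
  match R.rw P with
  | some w => ⟨.reach, some w⟩
  | none => R.gapItem P

/-- **THE `by_P` LOOKUP** (precedence computed > reach > interval > unrouted). [folklore] -/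
def lookup (P : π) : Item ω :=
  if P ∈ R.pts then ⟨.computed, some (R.cw P)⟩ else R.offItem P

/-- Two CONSECUTIVE computed pressures: both computed, `a < b`, no computed pressure strictly
between. [folklore] -/
@[folklore]
def Consecutive (a b : π) : Prop :=
  a ∈ R.pts ∧ b ∈ R.pts ∧ a < b ∧ ∀ c ∈ R.pts, ¬(a < c ∧ c < b)

/-- A DECIDED gap: consecutive computed pressures `a < b` whose interval word is `some w` with BOTH
end words equal to `w` (the `end_words = interval_word` invariant of `router/P-INTERVALS.tsv`;
for a certified sub-interval it is the theorem `Router.IntervalCert.route_left/route_right`).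
[folklore] -/
@[folklore]
def Decided (a b : π) (w : ω) : Prop :=
  R.Consecutive a b ∧ R.gw a = some w ∧ R.cw a = w ∧ R.cw b = w

/-! ### Computed columns -/

/-- At a computed pressure the item is the computed column with its word of record. [folklore] -/
theorem lookup_of_mem {P : π} (h : P ∈ R.pts) : R.lookup P = ⟨.computed, some (R.cw P)⟩ := by
  simp [lookup, h]

/-- Off the computed pressures the item is the reach/gap item. [folklore] -/
theorem lookup_of_not_mem {P : π} (h : P ∉ R.pts) : R.lookup P = R.offItem P := by
  simp [lookup, h]

/-- A gap item is never of kind `computed`. [folklore] -/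
theorem gapItem_kind_ne (P : π) : (R.gapItem P).kind ≠ .computed := by
  unfold gapItem
  rcases R.gapLeft P with _ | a <;> rcases R.gapRight P with _ | b <;> simp

/-- An off-column item is never of kind `computed`. [folklore] -/
theorem offItem_kind_ne (P : π) : (R.offItem P).kind ≠ .computed := by
  unfold offItem
  rcases R.rw P with _ | w
  · exact R.gapItem_kind_ne P
  · simp

/-- **An item is «computed» iff its pressure IS a computed column** — the join never manufactures
a computed cell (oracle-dag E18 (3); ACCEPTANCE: interpolated/extrapolated are never «computed»).
[folklore] -/
theorem kind_eq_computed_iff (P : π) : (R.lookup P).kind = .computed ↔ P ∈ R.pts := by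
  by_cases h : P ∈ R.pts
  · simp [R.lookup_of_mem h, h]
  · simp only [R.lookup_of_not_mem h, h, iff_false]
    exact R.offItem_kind_ne P

/-- An item's class is «screening» iff its kind is `computed`. [folklore] -/
theorem _root_.Summit.Ventures.CertifiedManyBodySolver.Downfold.PCont.Item.conf_eq_screening_iff
    (it : Item ω) : it.conf = .screening ↔ it.kind = .computed := by
  obtain ⟨k, w⟩ := it
  cases k <;> cases w <;> simp [Item.conf]

/-- Equivalently: the confidence class is «screening» iff the pressure is a computed column.
[folklore] -/
theorem conf_eq_screening_iff (P : π) : (R.lookup P).conf = .screening ↔ P ∈ R.pts := by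
  rw [Item.conf_eq_screening_iff, R.kind_eq_computed_iff]

/-! ### Inside a gap -/

variable {R}

/-- A pressure strictly between two consecutive computed pressures is not computed. [folklore] -/
theorem Consecutive.not_mem {a b P : π} (hc : R.Consecutive a b) (haP : a < P) (hPb : P < b) :
    P ∉ R.pts := fun hP => hc.2.2.2 P hP ⟨haP, hPb⟩

/-- **Inside the gap `(a, b)` the nearest computed pressure below is `a`.** [folklore] -/
theorem gapLeft_eq {a b P : π} (hc : R.Consecutive a b) (haP : a < P) (hPb : P < b) :
    R.gapLeft P = some a := by
  have ha : a ∈ R.below P := Finset.mem_filter.2 ⟨hc.1, haP⟩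
  have hne : (R.below P).Nonempty := ⟨a, ha⟩
  unfold gapLeft
  rw [dif_pos hne, Option.some.injEq]
  refine le_antisymm (Finset.max'_le _ hne _ fun y hy => ?_) (Finset.le_max' _ _ ha)
  obtain ⟨hy, hyP⟩ := Finset.mem_filter.1 hy
  by_contra hay
  exact hc.2.2.2 y hy ⟨lt_of_not_ge hay, hyP.trans hPb⟩

/-- **Inside the gap `(a, b)` the nearest computed pressure above is `b`.** [folklore] -/
theorem gapRight_eq {a b P : π} (hc : R.Consecutive a b) (haP : a < P) (hPb : P < b) :
    R.gapRight P = some b := by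
  have hb : b ∈ R.above P := Finset.mem_filter.2 ⟨hc.2.1, hPb⟩
  have hne : (R.above P).Nonempty := ⟨b, hb⟩
  unfold gapRight
  rw [dif_pos hne, Option.some.injEq]
  refine le_antisymm (Finset.min'_le _ _ hb) (Finset.le_min' _ hne _ fun y hy => ?_)
  obtain ⟨hy, hPy⟩ := Finset.mem_filter.1 hy
  by_contra hyb
  exact hc.2.2.2 y hy ⟨haP.trans hPy, lt_of_not_ge hyb⟩

/-- Inside the gap `(a, b)` the gap item is the interval item of that gap. [folklore] -/
theorem gapItem_of_mem_gap {a b P : π} (hc : R.Consecutive a b) (haP : a < P) (hPb : P < b) :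
    R.gapItem P = ⟨.interval, R.gw a⟩ := by
  unfold gapItem
  rw [gapLeft_eq hc haP hPb, gapRight_eq hc haP hPb]

/-- **Inside a reach-free gap the item is the INTERVAL item**: kind `interval`, word = the gap's
interval word (`some w` «interpolated» or `none` «undetermined»). [folklore] -/
theorem lookup_of_mem_gap {a b P : π} (hc : R.Consecutive a b) (haP : a < P) (hPb : P < b)
    (hr : R.rw P = none) : R.lookup P = ⟨.interval, R.gw a⟩ := by
  rw [R.lookup_of_not_mem (hc.not_mem haP hPb)]
  unfold offItem
  rw [hr]
  exact gapItem_of_mem_gap hc haP hPb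

/-- **A reach item never sits on a computed column and beats the interval item** where a reach
covers a non-computed pressure (the FLANK word inside an undetermined gap, §P.12(h)/(c′)).
[folklore] -/
theorem lookup_reach_of_not_mem {P : π} {w : ω} (hP : P ∉ R.pts) (hr : R.rw P = some w) :
    R.lookup P = ⟨.reach, some w⟩ := by
  rw [R.lookup_of_not_mem hP]
  unfold offItem
  rw [hr]

/-! ### A decided gap: words extend, confidence does not -/

/-- **On a DECIDED, reach-free gap the WORD `w` is the item's word at EVERY pressure of the CLOSED
gap `[a, b]`** — at the two computed ends (their words of record are `w`) and strictly inside (the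
interval word is `w`). [folklore] -/
theorem word_eq_on_gap_of_decided {a b : π} {w : ω} (hd : R.Decided a b w)
    (hr : ∀ P, a < P → P < b → R.rw P = none) {P : π} (haP : a ≤ P) (hPb : P ≤ b) :
    (R.lookup P).word = some w := by
  obtain ⟨hc, hgw, hca, hcb⟩ := hd
  rcases haP.lt_or_eq with haP | rfl
  · rcases hPb.lt_or_eq with hPb | rfl
    · rw [lookup_of_mem_gap hc haP hPb (hr P haP hPb), hgw]
    · rw [R.lookup_of_mem hc.2.1, hcb]
  · rw [R.lookup_of_mem hc.1, hca]

/-- **… while the CONFIDENCE CLASS does not extend**: strictly inside the decided gap the item is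
«interpolated», never «screening». [folklore] -/
theorem conf_lookup_of_mem_gap {a b : π} {w : ω} (hd : R.Decided a b w)
    (hr : ∀ P, a < P → P < b → R.rw P = none) {P : π} (haP : a < P) (hPb : P < b) :
    (R.lookup P).conf = .interpolated := by
  obtain ⟨hc, hgw, -, -⟩ := hd
  rw [lookup_of_mem_gap hc haP hPb (hr P haP hPb), hgw]
  rfl

/-- At the two END columns of a decided gap the class is «screening» (computed cells). [folklore] -/
theorem conf_lookup_ends_of_decided {a b : π} {w : ω} (hd : R.Decided a b w) :
    (R.lookup a).conf = .screening ∧ (R.lookup b).conf = .screening := by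
  obtain ⟨hc, -, -, -⟩ := hd
  exact ⟨by rw [R.lookup_of_mem hc.1]; rfl, by rw [R.lookup_of_mem hc.2.1]; rfl⟩

/-- **An UNDETERMINED, reach-free gap carries NO word strictly inside** (class «none»), whatever the
two end words are. [folklore] -/
theorem word_lookup_of_undetermined {a b P : π} (hc : R.Consecutive a b) (hgw : R.gw a = none)
    (hr : R.rw P = none) (haP : a < P) (hPb : P < b) :
    (R.lookup P).word = none ∧ (R.lookup P).conf = .none := by
  rw [lookup_of_mem_gap hc haP hPb hr, hgw]
  exact ⟨rfl, rfl⟩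

end Rec

end PCont

end Summit.Ventures.CertifiedManyBodySolver.Downfold
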